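import Summits.SmoothPoincare4.SmoothPoincare4.Theorems.CongruenceShadowsGriffithsHandlebodyExtensionCoverCore
import Summits.SmoothPoincare4.SmoothPoincare4.Theorems.CongruenceShadowsGriffithsHandlebodyExtensionCoverMap
import HarnessLib

/-!
# SmoothPoincare4 / CongruenceShadows — `GriffithsHandlebodyExtension` (item stmt-SmoothPoincare4-15190): descent of `Ψ̂` to the solid torus (E6)

Support file (`--supports` stmt-SmoothPoincare4-15190) of the homothety-cover proof of the genus-one
clause (E) of Griffiths' handlebody extension theorem — *every self-diffeomorphism of the Heegaard torus
`∂V` of the round solid torus fixing the base point and acting trivially on `π₁(∂V)` extends to a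
self-diffeomorphism of `V`* (hypothesis `hE` of
`Literature.Topology.FourManifolds.RoundSolidTorusModel.diffeoExtends_of_map_ker_eq_ker_of_forall_diffeoExtends`).
See the module docstring of `…CoverDefs` for the whole line (E1–E6) and the notation
(`τ̂`, `δ_λ`, `ρ`, `χ`, `f`, `Δ^(c)`, `α`, `L`, `M`, `Ψ̂`, `ẽ_c`).

This part (E6): the equivariant local diffeomorphism `Ψ̂` of `CoreData.core` descends through `covMap` to a
self-diffeomorphism `solidDiffeo` of the round solid torus (as a `RegularSublevel`), and
`CoreData.diffeoExtends_of_lift`: if `τ̂` lifts the boundary diffeomorphism `τV`, then `τV` extends over `V`.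
-/

-- the registered namespace `Summit.SmoothPoincare4.SmoothPoincare4.Theorems` repeats a component
set_option linter.dupNamespace false

noncomputable section

namespace Summit.SmoothPoincare4.SmoothPoincare4.Theorems

namespace HomothetyCover

open Set Function Metric Filter
open scoped Topology ContDiff

section Descent

open Literature.Topology.FourManifolds Literature.Topology.FourManifolds.RoundSolidTorusModel
open Complex (I)
open scoped Manifold

namespace CoreData

variable (D : CoreData)

/-- The descended map on `ℝ³`: `v ↦ P (Ψ̂ (S₀ v))` (principal section, then `Ψ̂`, then `P`). -/
def descFun (v : EuclideanSpace ℝ (Fin 3)) : EuclideanSpace ℝ (Fin 3) :=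
  covMap D.lam (D.Ψ (secMap D.lam 0 v))

/-- The descended inverse: `v ↦ P (Ψ̂' (S₀ v))`. -/
def descFun' (v : EuclideanSpace ℝ (Fin 3)) : EuclideanSpace ℝ (Fin 3) :=
  covMap D.lam (D.Ψ' (secMap D.lam 0 v))

/-- Points of the solid torus `{G ≤ 0}` stay off the axis `v₀ = v₁ = 0`. -/
theorem sq_add_sq_pos_of_G_nonpos {v : EuclideanSpace ℝ (Fin 3)} (hv : G v ≤ 0) :
    0 < v 0 ^ 2 + v 1 ^ 2 :=
  lt_of_lt_of_le (by norm_num) (three_le_sq_add_sq_of_G_nonpos hv)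

/-- **Section independence**: any local section may replace the principal one. -/
theorem covMap_Ψ_secMap {v : EuclideanSpace ℝ (Fin 3)} (hv : G v ≤ 0) (φ₀ : ℝ) :
    covMap D.lam (D.Ψ (secMap D.lam φ₀ v)) = D.descFun v := by
  have hv' := sq_add_sq_pos_of_G_nonpos hv
  have h1 : secMap D.lam φ₀ v ∈ Hpunct := secMap_mem hv φ₀
  have h0 : secMap D.lam 0 v ∈ Hpunct := secMap_mem hv 0
  have he : covMap D.lam (secMap D.lam φ₀ v) = covMap D.lam (secMap D.lam 0 v) := by
    rw [covMap_secMap D.one_lt_lam φ₀ hv', covMap_secMap D.one_lt_lam 0 hv']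
  obtain ⟨n, hn⟩ := exists_zpow_smul_of_covMap_eq D.one_lt_lam h1 h0 he
  rw [descFun, hn, D.Ψ_zpow_smul n h0, covMap_zpow_smul D.one_lt_lam n (D.Ψ_mem h0)]

/-- Section independence for the inverse. -/
theorem covMap_Ψ'_secMap {v : EuclideanSpace ℝ (Fin 3)} (hv : G v ≤ 0) (φ₀ : ℝ) :
    covMap D.lam (D.Ψ' (secMap D.lam φ₀ v)) = D.descFun' v := by
  have hv' := sq_add_sq_pos_of_G_nonpos hv
  have h1 : secMap D.lam φ₀ v ∈ Hpunct := secMap_mem hv φ₀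
  have h0 : secMap D.lam 0 v ∈ Hpunct := secMap_mem hv 0
  have he : covMap D.lam (secMap D.lam φ₀ v) = covMap D.lam (secMap D.lam 0 v) := by
    rw [covMap_secMap D.one_lt_lam φ₀ hv', covMap_secMap D.one_lt_lam 0 hv']
  obtain ⟨n, hn⟩ := exists_zpow_smul_of_covMap_eq D.one_lt_lam h1 h0 he
  rw [descFun', hn, D.Ψ'_zpow_smul n h0, covMap_zpow_smul D.one_lt_lam n (D.Ψ'_mem h0)]

/-- The descended map preserves the solid torus `{G ≤ 0}`. -/
theorem G_descFun_nonpos {v : EuclideanSpace ℝ (Fin 3)} (hv : G v ≤ 0) : G (D.descFun v) ≤ 0 :=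
  G_covMap_nonpos (D.Ψ_mem (secMap_mem hv 0))

/-- The descended inverse preserves the solid torus `{G ≤ 0}`. -/
theorem G_descFun'_nonpos {v : EuclideanSpace ℝ (Fin 3)} (hv : G v ≤ 0) : G (D.descFun' v) ≤ 0 :=
  G_covMap_nonpos (D.Ψ'_mem (secMap_mem hv 0))

/-- `descFun' ∘ descFun = id` on `V`. -/
theorem descFun'_descFun {v : EuclideanSpace ℝ (Fin 3)} (hv : G v ≤ 0) :
    D.descFun' (D.descFun v) = v := by
  have hv' := sq_add_sq_pos_of_G_nonpos hv
  have ha1 : secMap D.lam 0 v ∈ Hpunct := secMap_mem hv 0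
  have hb : D.Ψ (secMap D.lam 0 v) ∈ Hpunct := D.Ψ_mem ha1
  have hu : G (D.descFun v) ≤ 0 := D.G_descFun_nonpos hv
  have hs : secMap D.lam 0 (D.descFun v) ∈ Hpunct := secMap_mem hu 0
  have he : covMap D.lam (secMap D.lam 0 (D.descFun v)) = covMap D.lam (D.Ψ (secMap D.lam 0 v)) := by
    rw [covMap_secMap D.one_lt_lam 0 (sq_add_sq_pos_of_G_nonpos hu)]; rfl
  obtain ⟨n, hn⟩ := exists_zpow_smul_of_covMap_eq D.one_lt_lam hs hb he
  rw [descFun', hn, D.Ψ'_zpow_smul n hb, D.Ψ'_Ψ ha1, covMap_zpow_smul D.one_lt_lam n ha1,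
    covMap_secMap D.one_lt_lam 0 hv']

/-- `descFun ∘ descFun' = id` on `V`. -/
theorem descFun_descFun' {v : EuclideanSpace ℝ (Fin 3)} (hv : G v ≤ 0) :
    D.descFun (D.descFun' v) = v := by
  have hv' := sq_add_sq_pos_of_G_nonpos hv
  have ha1 : secMap D.lam 0 v ∈ Hpunct := secMap_mem hv 0
  have hb : D.Ψ' (secMap D.lam 0 v) ∈ Hpunct := D.Ψ'_mem ha1
  have hu : G (D.descFun' v) ≤ 0 := D.G_descFun'_nonpos hv
  have hs : secMap D.lam 0 (D.descFun' v) ∈ Hpunct := secMap_mem hu 0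
  have he : covMap D.lam (secMap D.lam 0 (D.descFun' v)) = covMap D.lam (D.Ψ' (secMap D.lam 0 v)) := by
    rw [covMap_secMap D.one_lt_lam 0 (sq_add_sq_pos_of_G_nonpos hu)]; rfl
  obtain ⟨n, hn⟩ := exists_zpow_smul_of_covMap_eq D.one_lt_lam hs hb he
  rw [descFun, hn, D.Ψ_zpow_smul n hb, D.Ψ_Ψ' ha1, covMap_zpow_smul D.one_lt_lam n ha1,
    covMap_secMap D.one_lt_lam 0 hv']

/-- The section-`φ₀` reading of `descFun` is smooth at `v` when `φ₀ = arg (longC v)`. -/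
theorem contDiffAt_covMap_Ψ_secMap {v : EuclideanSpace ℝ (Fin 3)} (hv : G v ≤ 0) :
    ContDiffAt ℝ ∞ (fun v' => covMap D.lam (D.Ψ (secMap D.lam (Complex.arg (longC v)) v'))) v := by
  have hv' := sq_add_sq_pos_of_G_nonpos hv
  have h1 : ContDiffAt ℝ ∞ (secMap D.lam (Complex.arg (longC v))) v :=
    contDiffAt_secMap hv' (slitPlane_self hv')
  have hm : secMap D.lam (Complex.arg (longC v)) v ∈ Hpunct := secMap_mem hv _
  have h2 : ContDiffAt ℝ ∞ D.Ψ (secMap D.lam (Complex.arg (longC v)) v) := D.contDiffAt_Ψ hm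
  have h3 : ContDiffAt ℝ ∞ (covMap D.lam) (D.Ψ (secMap D.lam (Complex.arg (longC v)) v)) :=
    contDiffAt_covMap (D.Ψ_mem hm)
  have h4 : ContDiffAt ℝ ∞ (covMap D.lam ∘ (D.Ψ ∘ secMap D.lam (Complex.arg (longC v)))) v :=
    h3.comp v (h2.comp v h1)
  exact h4

/-- The same for the inverse. -/
theorem contDiffAt_covMap_Ψ'_secMap {v : EuclideanSpace ℝ (Fin 3)} (hv : G v ≤ 0) :
    ContDiffAt ℝ ∞ (fun v' => covMap D.lam (D.Ψ' (secMap D.lam (Complex.arg (longC v)) v'))) v := by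
  have hv' := sq_add_sq_pos_of_G_nonpos hv
  have h1 : ContDiffAt ℝ ∞ (secMap D.lam (Complex.arg (longC v))) v :=
    contDiffAt_secMap hv' (slitPlane_self hv')
  have hm : secMap D.lam (Complex.arg (longC v)) v ∈ Hpunct := secMap_mem hv _
  have h2 : ContDiffAt ℝ ∞ D.Ψ' (secMap D.lam (Complex.arg (longC v)) v) := D.contDiffAt_Ψ' hm
  have h3 : ContDiffAt ℝ ∞ (covMap D.lam) (D.Ψ' (secMap D.lam (Complex.arg (longC v)) v)) :=
    contDiffAt_covMap (D.Ψ'_mem hm)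
  have h4 : ContDiffAt ℝ ∞ (covMap D.lam ∘ (D.Ψ' ∘ secMap D.lam (Complex.arg (longC v)))) v :=
    h3.comp v (h2.comp v h1)
  exact h4

/-! #### The extension as a self-diffeomorphism of `V` -/

/-- **The extension `Ψ_V` as a self-map of the round solid torus `V`.** -/
def solidMap (q : RoundSolidTorus) : RoundSolidTorus :=
  RegularSublevel.mk isRegularLevel_fn (D.descFun (RegularSublevel.incl isRegularLevel_fn q))
    ((fn_nonpos_iff _).2 (D.G_descFun_nonpos (G_incl_nonpos q)))

/-- Its inverse. -/
def solidMap' (q : RoundSolidTorus) : RoundSolidTorus :=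
  RegularSublevel.mk isRegularLevel_fn (D.descFun' (RegularSublevel.incl isRegularLevel_fn q))
    ((fn_nonpos_iff _).2 (D.G_descFun'_nonpos (G_incl_nonpos q)))

/-- Underlying point of `solidMap q`: the descended map applied to the underlying point of `q`. -/
@[simp] theorem incl_solidMap (q : RoundSolidTorus) :
    RegularSublevel.incl isRegularLevel_fn (D.solidMap q) = D.descFun (RegularSublevel.incl isRegularLevel_fn q) :=
  rfl

/-- Underlying point of `solidMap' q`: the descended inverse applied to the underlying point of `q`. -/
@[simp] theorem incl_solidMap' (q : RoundSolidTorus) :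
    RegularSublevel.incl isRegularLevel_fn (D.solidMap' q) = D.descFun' (RegularSublevel.incl isRegularLevel_fn q) :=
  rfl

/-- `Ψ_V` is smooth for the manifold-with-boundary structure of `V`. -/
theorem contMDiff_solidMap : ContMDiff (𝓡∂ 3) (𝓡∂ 3) ∞ D.solidMap := by
  intro q
  set v := RegularSublevel.incl isRegularLevel_fn q with hv
  have hG : G v ≤ 0 := G_incl_nonpos q
  have heq : (fun q' : RoundSolidTorus => D.descFun (RegularSublevel.incl isRegularLevel_fn q')) =
      (fun v' => covMap D.lam (D.Ψ (secMap D.lam (Complex.arg (longC v)) v'))) ∘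
        RegularSublevel.incl isRegularLevel_fn :=
    funext fun q' => (D.covMap_Ψ_secMap (G_incl_nonpos q') _).symm
  have h1 : ContMDiffAt (𝓡∂ 3) (𝓡 3) ∞
      (fun q' : RoundSolidTorus => D.descFun (RegularSublevel.incl isRegularLevel_fn q')) q := by
    rw [heq]
    exact (D.contDiffAt_covMap_Ψ_secMap hG).contMDiffAt.comp q
      ((RegularSublevel.contMDiff_incl isRegularLevel_fn) q)
  exact HalfSliceAtlas.contMDiffAt_codRestrict (RegularSublevel.halfSliceAtlas isRegularLevel_fn)
    (g := fun q' : RoundSolidTorus => D.descFun (RegularSublevel.incl isRegularLevel_fn q'))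
    (fun q' => (D.solidMap q').2) h1

/-- `Ψ_V⁻¹` is smooth. -/
theorem contMDiff_solidMap' : ContMDiff (𝓡∂ 3) (𝓡∂ 3) ∞ D.solidMap' := by
  intro q
  set v := RegularSublevel.incl isRegularLevel_fn q with hv
  have hG : G v ≤ 0 := G_incl_nonpos q
  have heq : (fun q' : RoundSolidTorus => D.descFun' (RegularSublevel.incl isRegularLevel_fn q')) =
      (fun v' => covMap D.lam (D.Ψ' (secMap D.lam (Complex.arg (longC v)) v'))) ∘
        RegularSublevel.incl isRegularLevel_fn :=
    funext fun q' => (D.covMap_Ψ'_secMap (G_incl_nonpos q') _).symm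
  have h1 : ContMDiffAt (𝓡∂ 3) (𝓡 3) ∞
      (fun q' : RoundSolidTorus => D.descFun' (RegularSublevel.incl isRegularLevel_fn q')) q := by
    rw [heq]
    exact (D.contDiffAt_covMap_Ψ'_secMap hG).contMDiffAt.comp q
      ((RegularSublevel.contMDiff_incl isRegularLevel_fn) q)
  exact HalfSliceAtlas.contMDiffAt_codRestrict (RegularSublevel.halfSliceAtlas isRegularLevel_fn)
    (g := fun q' : RoundSolidTorus => D.descFun' (RegularSublevel.incl isRegularLevel_fn q'))
    (fun q' => (D.solidMap' q').2) h1

/-- **The extension `Ψ_V : V ≅ V`** descended from the core `Ψ̂`. -/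
def solidDiffeo : RoundSolidTorus ≃ₘ⟮𝓡∂ 3, 𝓡∂ 3⟯ RoundSolidTorus where
  toFun := D.solidMap
  invFun := D.solidMap'
  left_inv q := RegularSublevel.injective_incl isRegularLevel_fn
    (by rw [incl_solidMap', incl_solidMap, D.descFun'_descFun (G_incl_nonpos q)])
  right_inv q := RegularSublevel.injective_incl isRegularLevel_fn
    (by rw [incl_solidMap, incl_solidMap', D.descFun_descFun' (G_incl_nonpos q)])
  contMDiff_toFun := D.contMDiff_solidMap
  contMDiff_invFun := D.contMDiff_solidMap'

/-- `solidDiffeo` acts by `solidMap`. -/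
@[simp] theorem solidDiffeo_apply (q : RoundSolidTorus) : D.solidDiffeo q = D.solidMap q := rfl

/-- On the boundary torus the principal section lands in the boundary plane. -/
theorem secMap_boundary_eq (z : (𝓡∂ 3).boundary RoundSolidTorus) :
    secMap D.lam 0 (RegularSublevel.incl isRegularLevel_fn z.1) =
      ((secMap D.lam 0 (RegularSublevel.incl isRegularLevel_fn z.1)).1, 0) ∧
    (secMap D.lam 0 (RegularSublevel.incl isRegularLevel_fn z.1)).1 ≠ 0 := by
  set v := RegularSublevel.incl isRegularLevel_fn z.1 with hv
  have hG0 : G v = 0 := (fn_eq_zero_iff _).1 (RegularSublevel.apply_incl_boundary isRegularLevel_fn z)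
  have hmem : secMap D.lam 0 v ∈ Hpunct := secMap_mem hG0.le 0
  have hcov : G (covMap D.lam (secMap D.lam 0 v)) = 0 := by
    rw [covMap_secMap D.one_lt_lam 0 (sq_add_sq_pos_of_G_nonpos hG0.le), hG0]
  have h2 : (secMap D.lam 0 v).2 = 0 := snd_eq_zero_of_G_covMap hmem hcov
  refine ⟨Prod.ext rfl h2, fun h => hmem.2 (Prod.ext h h2)⟩

/-- **Griffiths, genus one, extension form, from the core**: if the boundary diffeomorphism `τ`
of `∂V` is covered, through `P`, by the lifted `τ̂ = D.τ` on the boundary plane, then `τ` extends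
to the self-diffeomorphism `Ψ_V` of the round solid torus: `BoundaryData.DiffeoExtends`. -/
theorem diffeoExtends_of_lift
    (τV : (𝓡∂ 3).boundary RoundSolidTorus ≃ₘ⟮𝓡 2, 𝓡 2⟯ (𝓡∂ 3).boundary RoundSolidTorus)
    (hlift : ∀ (y : E2), y ≠ 0 → ∀ z : (𝓡∂ 3).boundary RoundSolidTorus,
      RegularSublevel.incl isRegularLevel_fn z.1 = covMap D.lam (y, 0) →
      RegularSublevel.incl isRegularLevel_fn (τV z).1 = covMap D.lam (D.τ y, 0)) :
    (BoundaryManifold.boundaryData 2 RoundSolidTorus).DiffeoExtends τV := by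
  refine ⟨D.solidDiffeo, funext fun z => ?_⟩
  show D.solidMap z.1 = (τV z).1
  apply RegularSublevel.injective_incl isRegularLevel_fn
  rw [incl_solidMap, descFun]
  obtain ⟨h1, hy⟩ := D.secMap_boundary_eq z
  set y := (secMap D.lam 0 (RegularSublevel.incl isRegularLevel_fn z.1)).1 with hydef
  rw [h1, D.Ψ_boundary hy]
  refine (hlift y hy z ?_).symm
  rw [← h1]
  have hG : G (RegularSublevel.incl isRegularLevel_fn z.1) ≤ 0 := G_incl_nonpos z.1
  exact (covMap_secMap D.one_lt_lam 0 (sq_add_sq_pos_of_G_nonpos hG)).symm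

end CoreData

end Descent

end HomothetyCover

end Summit.SmoothPoincare4.SmoothPoincare4.Theorems

end
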